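import Summits.QuantumAdvantage.QuantumAdvantage.Theorems.SpreadBridge
import Summits.QuantumAdvantage.QuantumAdvantage.Theorems.RingSymmetrizationLaw3
import Literature.Computability.MetaComplexity.LowDegreeComposition
import HarnessLib

/-!
# OrbitAveraging — orbit averaging for UNIFORM ring strategies over `𝔽₃`, the coset law, the one-polynomial normal
# form of `RingHardOdd 3`, the hybrid lemma in the `ℤ_n^m`-equivariant class, and the EQUIVARIANT NORMAL FORM of the
# many-ring target (`MultiRingHard3 ↔` its equivariant restriction)

Prover-side twin of the decomp-qadv lens-5 workshop node «OrbitDial» (generation 11, rev 3).  Prop-free: every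
statement is spelled out (no `def … : Prop`); definitions: the Boolean input parity `par` and the §8 normal-form
machinery (`qc`, `canonT`, `ptil`, `psym`, `zT`, `goodT`, `rotT`).

* ORBIT AVERAGING (§4): for a rotation-INVARIANT predicate `L` and any event `E`,
  `#(L ∧ ∃ r, E∘rot_r) ≤ n · #(L ∧ E)` (`orbit_avg_ge`, Cauchy–Frobenius double counting; `card_inv_and_rot`);
  the TRIANGULAR COUNT `#{x : ∀ r, par_S(rot_r x) = c} ≤ 2^M` for `S ⊆ [0,M)` nonempty (`card_allShifts_le`);
  hence `coset_core`: `#(odd losses of cov Q) ≤ n · #(odd losses inside {par_S(rot_a ·) = b}) + 2^M`.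
* THE COSET LAW (`covSliceLoss_of_polyLossOddU3`): from the odd-class polynomial loss `ExactnessDial.PolyLossOddU3`
  (item 26531, OPEN — the law is relative to it), exponent `C`: every UNIFORM rule `cov Q` of polylog degree loses
  `≥ 2ⁿ/n^(C+2)` odd patterns inside EVERY coset `{⊕_{j∈S} x_{j+a} = b}` with `S ⊆ [0,M)` nonempty and
  `M + (C+2)(log₂ n+1) ≤ n` (in particular every `#S ≤ √n`, every translate).
* THE ONE-POLYNOMIAL NORMAL FORM OF T at constant grade (`ringHardOdd3_iff_cov`): `RingHardOdd 3` ↔ the same bound for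
  ONE covariant polynomial (`RingSymmetrization3.symmetrization3` + `RingLeaderElection3.exists_election3`).
* THE HYBRID LEMMA IN THE EQUIVARIANT CLASS (`card_winAllSet_le_hybrid_eqv`, `hybridEqv3`): for own-covariant,
  foreign-invariant joint strategies the fibre victim is the uniform rule `cov Q₀` and the foreign win event has
  rotation-invariant bits, so invariant-foreign spread for uniform victims gives many-ring hardness in that class.
* THE EQUIVARIANT NORMAL FORM LAW (§8, `multiRingHard3_of_equivariant`, `multiRingHard3_iff_equivariant`): many-ring
  hardness (`SpreadDial.MultiRingHard3`, item 26122) is EQUIVALENT to many-ring hardness against ring-wise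
  EQUIVARIANT joint strategies (each ring covariant in its own input, invariant under rotating any other ring):
  ring-wise leader election, invariant canonical coordinates `q² ∈ {0,1}`, the symmetrised strategy `psym`
  (`psym_mem`, `psym_equivariant`), win transport (`win_transport`), phase averaging (`phase_sum`, `exists_phase`).
* RECORDS: `invSpreadLoss3_of_spreadLoss3`, `covSpreadLoss3_of_spreadLoss3` (restrictions of 29064),
  `invSpreadLoss3_of_ringHardOdd` (necessity for T), `multiRingHard3_of_invSpread` (invariant-foreign spread for
  uniform victims ⇒ 26122 outright) and the BY-NAME corollaries `adviceFreeQNC0Three_of_orbitDial` (leaf from 26123 +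
  the normal-form residual) / `adviceFreeQNC0Three_of_invSpread`.
No `def … : Prop`, no `instance`, no `notation`, no `sorry`.
-/

set_option linter.dupNamespace false
set_option linter.style.longLine false
set_option linter.unusedVariables false

noncomputable section

open scoped Classical

namespace Summit.QuantumAdvantage.QuantumAdvantage.Theorems.OrbitAveraging

open Finset
open Literature.Computability.QuantumComplexity Literature.Computability.QuantumComplexity.RingHLF
open Literature.Computability.MetaComplexity Literature.Computability.MetaComplexity.Smolensky
open Summit.QuantumAdvantage.AdviceFreeQNC0
open Summit.QuantumAdvantage.QuantumAdvantage.Theorems (flat)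
open Summit.QuantumAdvantage.QuantumAdvantage.Theorems.RingPeriodFold (cov covStrat covStrat_mem_lowDeg cov_eq_covStrat)
open Summit.QuantumAdvantage.QuantumAdvantage.Theorems.SpreadBridge (JointStrategy winAllSet sum_card_filter_update
  fibre_decrement decay_le_half)

/-! ## §1 Objects -/

variable {n : ℕ}

/-- the `𝔽₂`-parity of the bits of `y` indexed by `S` (`true` = odd), as in generation 10's CosetDial. -/
def par (S : Finset (Fin n)) (y : Fin n → Bool) : Bool :=
  decide ((S.filter fun j => y j = true).card % 2 = 1)

/-! ## §2 Pieces (statements) -/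

/-! ## §3 Order records (all PROVED): necessity and dominance -/

/-- R-side statement is NECESSARY for 29064: `SpreadLoss3 → (∃ η : ℝ, 0 < η ∧ ∃ k : ℕ, ∀ c : ℕ, ∃ n₀ : ℕ, ∀ n ≥ n₀, ∀ Q : CubeFn (ZMod 3) n,
  Q ∈ lowDeg (ZMod 3) n ((Nat.log 2 n) ^ c) →
  ∀ m : ℕ, m ≤ n ^ k → ∀ w : Fin m → Fin n → Bool, ∀ F : Fin m → Fin n → CubeFn (ZMod 3) n,
    (∀ t i, F t i ∈ lowDeg (ZMod 3) n ((Nat.log 2 n) ^ c)) →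
    (∀ t i y, decide (F t i (rot 1 y) = 1) = decide (F t i y = 1)) →
    (1 - η) * (2 : ℝ) ^ n ≤ ((univ.filter fun y : Fin n → Bool =>
        ∀ t, RingHLF.Rel (w t) (fun i => decide (F t i y = 1))).card : ℝ) →
    1 / (n : ℝ) ^ k * (2 : ℝ) ^ n ≤ ((univ.filter fun y : Fin n → Bool =>
        (∀ t, RingHLF.Rel (w t) (fun i => decide (F t i y = 1))) ∧ ¬ RingHLF.Rel y (cov Q y)).card : ℝ))` (restriction to the victim `covStrat Q`
and to invariant foreign bits). -/
theorem invSpreadLoss3_of_spreadLoss3 (h : Theses.SpreadDial.SpreadLoss3) : (∃ η : ℝ, 0 < η ∧ ∃ k : ℕ, ∀ c : ℕ, ∃ n₀ : ℕ, ∀ n ≥ n₀, ∀ Q : CubeFn (ZMod 3) n,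
  Q ∈ lowDeg (ZMod 3) n ((Nat.log 2 n) ^ c) →
  ∀ m : ℕ, m ≤ n ^ k → ∀ w : Fin m → Fin n → Bool, ∀ F : Fin m → Fin n → CubeFn (ZMod 3) n,
    (∀ t i, F t i ∈ lowDeg (ZMod 3) n ((Nat.log 2 n) ^ c)) →
    (∀ t i y, decide (F t i (rot 1 y) = 1) = decide (F t i y = 1)) →
    (1 - η) * (2 : ℝ) ^ n ≤ ((univ.filter fun y : Fin n → Bool =>
        ∀ t, RingHLF.Rel (w t) (fun i => decide (F t i y = 1))).card : ℝ) →
    1 / (n : ℝ) ^ k * (2 : ℝ) ^ n ≤ ((univ.filter fun y : Fin n → Bool =>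
        (∀ t, RingHLF.Rel (w t) (fun i => decide (F t i y = 1))) ∧ ¬ RingHLF.Rel y (cov Q y)).card : ℝ)) := by
  obtain ⟨η, hη, k, hk⟩ := h
  refine ⟨η, hη, k, fun c => ?_⟩
  obtain ⟨n₀, hn₀⟩ := hk c
  refine ⟨n₀, fun n hn Q hQ m hm w F hF _hinv hdens => ?_⟩
  exact hn₀ n hn (covStrat Q) (fun i => covStrat_mem_lowDeg hQ i) m hm w F hF hdens

/-- restriction: `SpreadLoss3 → (∃ η : ℝ, 0 < η ∧ ∃ k : ℕ, ∀ c : ℕ, ∃ n₀ : ℕ, ∀ n ≥ n₀, ∀ Q : CubeFn (ZMod 3) n,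
  Q ∈ lowDeg (ZMod 3) n ((Nat.log 2 n) ^ c) →
  ∀ m : ℕ, m ≤ n ^ k → ∀ w : Fin m → Fin n → Bool, ∀ F : Fin m → Fin n → CubeFn (ZMod 3) n,
    (∀ t i, F t i ∈ lowDeg (ZMod 3) n ((Nat.log 2 n) ^ c)) →
    (1 - η) * (2 : ℝ) ^ n ≤ ((univ.filter fun y : Fin n → Bool =>
        ∀ t, RingHLF.Rel (w t) (fun i => decide (F t i y = 1))).card : ℝ) →
    1 / (n : ℝ) ^ k * (2 : ℝ) ^ n ≤ ((univ.filter fun y : Fin n → Bool =>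
        (∀ t, RingHLF.Rel (w t) (fun i => decide (F t i y = 1))) ∧ ¬ RingHLF.Rel y (cov Q y)).card : ℝ))` (victim `covStrat Q`). -/
theorem covSpreadLoss3_of_spreadLoss3 (h : Theses.SpreadDial.SpreadLoss3) : (∃ η : ℝ, 0 < η ∧ ∃ k : ℕ, ∀ c : ℕ, ∃ n₀ : ℕ, ∀ n ≥ n₀, ∀ Q : CubeFn (ZMod 3) n,
  Q ∈ lowDeg (ZMod 3) n ((Nat.log 2 n) ^ c) →
  ∀ m : ℕ, m ≤ n ^ k → ∀ w : Fin m → Fin n → Bool, ∀ F : Fin m → Fin n → CubeFn (ZMod 3) n,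
    (∀ t i, F t i ∈ lowDeg (ZMod 3) n ((Nat.log 2 n) ^ c)) →
    (1 - η) * (2 : ℝ) ^ n ≤ ((univ.filter fun y : Fin n → Bool =>
        ∀ t, RingHLF.Rel (w t) (fun i => decide (F t i y = 1))).card : ℝ) →
    1 / (n : ℝ) ^ k * (2 : ℝ) ^ n ≤ ((univ.filter fun y : Fin n → Bool =>
        (∀ t, RingHLF.Rel (w t) (fun i => decide (F t i y = 1))) ∧ ¬ RingHLF.Rel y (cov Q y)).card : ℝ)) := by
  obtain ⟨η, hη, k, hk⟩ := h
  refine ⟨η, hη, k, fun c => ?_⟩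
  obtain ⟨n₀, hn₀⟩ := hk c
  refine ⟨n₀, fun n hn Q hQ m hm w F hF hdens => ?_⟩
  exact hn₀ n hn (covStrat Q) (fun i => covStrat_mem_lowDeg hQ i) m hm w F hF hdens

/-- restriction: `(∃ η : ℝ, 0 < η ∧ ∃ k : ℕ, ∀ c : ℕ, ∃ n₀ : ℕ, ∀ n ≥ n₀, ∀ Q : CubeFn (ZMod 3) n,
  Q ∈ lowDeg (ZMod 3) n ((Nat.log 2 n) ^ c) →
  ∀ m : ℕ, m ≤ n ^ k → ∀ w : Fin m → Fin n → Bool, ∀ F : Fin m → Fin n → CubeFn (ZMod 3) n,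
    (∀ t i, F t i ∈ lowDeg (ZMod 3) n ((Nat.log 2 n) ^ c)) →
    (1 - η) * (2 : ℝ) ^ n ≤ ((univ.filter fun y : Fin n → Bool =>
        ∀ t, RingHLF.Rel (w t) (fun i => decide (F t i y = 1))).card : ℝ) →
    1 / (n : ℝ) ^ k * (2 : ℝ) ^ n ≤ ((univ.filter fun y : Fin n → Bool =>
        (∀ t, RingHLF.Rel (w t) (fun i => decide (F t i y = 1))) ∧ ¬ RingHLF.Rel y (cov Q y)).card : ℝ)) → (∃ η : ℝ, 0 < η ∧ ∃ k : ℕ, ∀ c : ℕ, ∃ n₀ : ℕ, ∀ n ≥ n₀, ∀ Q : CubeFn (ZMod 3) n,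
  Q ∈ lowDeg (ZMod 3) n ((Nat.log 2 n) ^ c) →
  ∀ m : ℕ, m ≤ n ^ k → ∀ w : Fin m → Fin n → Bool, ∀ F : Fin m → Fin n → CubeFn (ZMod 3) n,
    (∀ t i, F t i ∈ lowDeg (ZMod 3) n ((Nat.log 2 n) ^ c)) →
    (∀ t i y, decide (F t i (rot 1 y) = 1) = decide (F t i y = 1)) →
    (1 - η) * (2 : ℝ) ^ n ≤ ((univ.filter fun y : Fin n → Bool =>
        ∀ t, RingHLF.Rel (w t) (fun i => decide (F t i y = 1))).card : ℝ) →
    1 / (n : ℝ) ^ k * (2 : ℝ) ^ n ≤ ((univ.filter fun y : Fin n → Bool =>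
        (∀ t, RingHLF.Rel (w t) (fun i => decide (F t i y = 1))) ∧ ¬ RingHLF.Rel y (cov Q y)).card : ℝ))` (forget the invariance hypothesis). -/
theorem invSpreadLoss3_of_covSpreadLoss3 (h : (∃ η : ℝ, 0 < η ∧ ∃ k : ℕ, ∀ c : ℕ, ∃ n₀ : ℕ, ∀ n ≥ n₀, ∀ Q : CubeFn (ZMod 3) n,
  Q ∈ lowDeg (ZMod 3) n ((Nat.log 2 n) ^ c) →
  ∀ m : ℕ, m ≤ n ^ k → ∀ w : Fin m → Fin n → Bool, ∀ F : Fin m → Fin n → CubeFn (ZMod 3) n,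
    (∀ t i, F t i ∈ lowDeg (ZMod 3) n ((Nat.log 2 n) ^ c)) →
    (1 - η) * (2 : ℝ) ^ n ≤ ((univ.filter fun y : Fin n → Bool =>
        ∀ t, RingHLF.Rel (w t) (fun i => decide (F t i y = 1))).card : ℝ) →
    1 / (n : ℝ) ^ k * (2 : ℝ) ^ n ≤ ((univ.filter fun y : Fin n → Bool =>
        (∀ t, RingHLF.Rel (w t) (fun i => decide (F t i y = 1))) ∧ ¬ RingHLF.Rel y (cov Q y)).card : ℝ))) : (∃ η : ℝ, 0 < η ∧ ∃ k : ℕ, ∀ c : ℕ, ∃ n₀ : ℕ, ∀ n ≥ n₀, ∀ Q : CubeFn (ZMod 3) n,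
  Q ∈ lowDeg (ZMod 3) n ((Nat.log 2 n) ^ c) →
  ∀ m : ℕ, m ≤ n ^ k → ∀ w : Fin m → Fin n → Bool, ∀ F : Fin m → Fin n → CubeFn (ZMod 3) n,
    (∀ t i, F t i ∈ lowDeg (ZMod 3) n ((Nat.log 2 n) ^ c)) →
    (∀ t i y, decide (F t i (rot 1 y) = 1) = decide (F t i y = 1)) →
    (1 - η) * (2 : ℝ) ^ n ≤ ((univ.filter fun y : Fin n → Bool =>
        ∀ t, RingHLF.Rel (w t) (fun i => decide (F t i y = 1))).card : ℝ) →
    1 / (n : ℝ) ^ k * (2 : ℝ) ^ n ≤ ((univ.filter fun y : Fin n → Bool =>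
        (∀ t, RingHLF.Rel (w t) (fun i => decide (F t i y = 1))) ∧ ¬ RingHLF.Rel y (cov Q y)).card : ℝ)) := by
  obtain ⟨η, hη, k, hk⟩ := h
  refine ⟨η, hη, k, fun c => ?_⟩
  obtain ⟨n₀, hn₀⟩ := hk c
  refine ⟨n₀, fun n hn Q hQ m hm w F hF _hinv hdens => ?_⟩
  exact hn₀ n hn Q hQ m hm w F hF hdens

/-- the equivariant target is NECESSARY for T*: `MultiRingHard3 → (∃ K : ℕ, ∃ θ : ℝ, θ < 1 ∧ ∀ c : ℕ, ∃ n₀ : ℕ, ∀ n ≥ n₀,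
  ∀ P : Fin (n ^ K) → Fin n → CubeFn (ZMod 3) (n ^ K * n), ((∀ (X : Fin (n ^ K) → Fin n → Bool) (j : Fin (n ^ K)) (y : Fin n → Bool) (r : ℕ) (i : Fin n),
      decide (P j i (flat (Function.update X j (rot r y))) = 1) =
        decide (P j (RingSymmetry.shift n r i) (flat (Function.update X j y)) = 1)) ∧
    (∀ (X : Fin (n ^ K) → Fin n → Bool) (j s : Fin (n ^ K)), s ≠ j → ∀ (y : Fin n → Bool) (i : Fin n),
      decide (P s i (flat (Function.update X j (rot 1 y))) = 1) =
        decide (P s i (flat (Function.update X j y)) = 1))) →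
    (∀ j i, P j i ∈ lowDeg (ZMod 3) (n ^ K * n) ((Nat.log 2 n) ^ c)) →
    ((univ.filter fun X : Fin (n ^ K) → Fin n → Bool => ∀ j, RingHLF.Rel (X j)
      (fun i => decide (P j i (fun k => X (finProdFinEquiv.symm k).1 (finProdFinEquiv.symm k).2) = 1))).card : ℝ)
      ≤ θ * (2 : ℝ) ^ (n ^ K * n))`. -/
theorem multiRingHardEqv3_of_multiRingHard3 (h : Theses.SpreadDial.MultiRingHard3) : (∃ K : ℕ, ∃ θ : ℝ, θ < 1 ∧ ∀ c : ℕ, ∃ n₀ : ℕ, ∀ n ≥ n₀,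
  ∀ P : Fin (n ^ K) → Fin n → CubeFn (ZMod 3) (n ^ K * n), ((∀ (X : Fin (n ^ K) → Fin n → Bool) (j : Fin (n ^ K)) (y : Fin n → Bool) (r : ℕ) (i : Fin n),
      decide (P j i (flat (Function.update X j (rot r y))) = 1) =
        decide (P j (RingSymmetry.shift n r i) (flat (Function.update X j y)) = 1)) ∧
    (∀ (X : Fin (n ^ K) → Fin n → Bool) (j s : Fin (n ^ K)), s ≠ j → ∀ (y : Fin n → Bool) (i : Fin n),
      decide (P s i (flat (Function.update X j (rot 1 y))) = 1) =
        decide (P s i (flat (Function.update X j y)) = 1))) →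
    (∀ j i, P j i ∈ lowDeg (ZMod 3) (n ^ K * n) ((Nat.log 2 n) ^ c)) →
    ((univ.filter fun X : Fin (n ^ K) → Fin n → Bool => ∀ j, RingHLF.Rel (X j)
      (fun i => decide (P j i (fun k => X (finProdFinEquiv.symm k).1 (finProdFinEquiv.symm k).2) = 1))).card : ℝ)
      ≤ θ * (2 : ℝ) ^ (n ^ K * n)) := by
  obtain ⟨K, θ, hθ, hh⟩ := h
  refine ⟨K, θ, hθ, fun c => ?_⟩
  obtain ⟨n₀, hn₀⟩ := hh c
  exact ⟨n₀, fun n hn P _ hP => hn₀ n hn P hP⟩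

/-- the constant-grade covariant law is NECESSARY for T (restriction to `covStrat Q`). -/
theorem covRingHardOdd3_of_ringHardOdd (h : RingHardOdd 3) : (∃ θ : ℝ, θ < 1 ∧ ∀ c : ℕ, ∃ n₀ : ℕ, ∀ n ≥ n₀, ∀ Q : CubeFn (ZMod 3) n,
  Q ∈ lowDeg (ZMod 3) n ((Nat.log 2 n) ^ c) →
    ((univ.filter fun x : Fin n → Bool => OddZeros x ∧ RingHLF.Rel x (cov Q x)).card : ℝ) ≤ θ * (2 : ℝ) ^ (n - 1)) := by
  obtain ⟨θ, hθ, hh⟩ := h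
  refine ⟨θ, hθ, fun c => ?_⟩
  obtain ⟨n₀, hn₀⟩ := hh c
  exact ⟨n₀, fun n hn Q hQ => hn₀ n hn (covStrat Q) (fun i => covStrat_mem_lowDeg hQ i)⟩

/-! ## §4 The uniform range (all PROVED): covariance, ORBIT AVERAGING, the triangular count, the COSET LAW -/

/-- reading a rotated pattern below the wrap-around: `(rot a y) j = y (j + a)` when `j + a < n`. -/
theorem rot_apply_of_lt (a : ℕ) (y : Fin n → Bool) (j : Fin n) (h : j.val + a < n) :
    rot a y j = y ⟨j.val + a, h⟩ := by
  show y ⟨(j.val + a) % n, _⟩ = y ⟨j.val + a, h⟩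
  congr 1
  exact Fin.ext (Nat.mod_eq_of_lt h)

/-- COVARIANCE of the uniform rule: `cov Q (rot r y) = rot r (cov Q y)`. -/
theorem cov_rot (Q : CubeFn (ZMod 3) n) (r : ℕ) (y : Fin n → Bool) : cov Q (rot r y) = rot r (cov Q y) := by
  funext b
  show decide (Q (rot b.val (rot r y)) = 1) = decide (Q (rot ((b.val + r) % n) y) = 1)
  rw [RingSymmetry.rot_rot, RingSymmetry.rot_mod]

/-- the uniform rule wins at `rot r y` iff it wins at `y` (`RingSymmetry.rel_rot`). -/
theorem rel_cov_rot_iff (Q : CubeFn (ZMod 3) n) (r : ℕ) (y : Fin n → Bool) :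
    RingHLF.Rel (rot r y) (cov Q (rot r y)) ↔ RingHLF.Rel y (cov Q y) := by
  rw [cov_rot]
  exact RingSymmetry.rel_rot r y (cov Q y)

/-- the odd-class loss set of a uniform rule is ROTATION-INVARIANT. -/
theorem oddLoss_rot_iff (Q : CubeFn (ZMod 3) n) (r : ℕ) (y : Fin n → Bool) :
    (OddZeros (rot r y) ∧ ¬ RingHLF.Rel (rot r y) (cov Q (rot r y))) ↔ (OddZeros y ∧ ¬ RingHLF.Rel y (cov Q y)) := by
  rw [Theorems.RingMinor.oddZeros_rot, rel_cov_rot_iff]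

/-- orbit sums: for a rotation-invariant predicate `L`, the count of `L ∧ E∘rot_r` does not depend on `r`. -/
theorem card_inv_and_rot (L E : (Fin n → Bool) → Prop) (hL : ∀ r : ℕ, ∀ y, L (rot r y) ↔ L y) (r : ℕ) :
    (univ.filter fun y => L y ∧ E (rot r y)).card = (univ.filter fun y => L y ∧ E y).card := by
  rw [← RingSymmetry.card_filter_rot r (fun y : Fin n → Bool => L y ∧ E y)]
  exact congrArg Finset.card (filter_congr fun y _ => by rw [hL r y])

/-- **ORBIT AVERAGING** (Cauchy–Frobenius double counting over the rotation group): for a rotation-invariant `L` and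
ANY event `E`, `#(L ∩ hull E) ≤ n · #(L ∩ E)`, where `hull E = ⋃_r rot_r⁻¹ E`. -/
theorem orbit_avg_ge (L E : (Fin n → Bool) → Prop) (hL : ∀ r : ℕ, ∀ y, L (rot r y) ↔ L y) :
    (univ.filter fun y => L y ∧ ∃ r : Fin n, E (rot r.val y)).card ≤ n * (univ.filter fun y => L y ∧ E y).card := by
  calc (univ.filter fun y => L y ∧ ∃ r : Fin n, E (rot r.val y)).card
      = ∑ y : Fin n → Bool, (if (L y ∧ ∃ r : Fin n, E (rot r.val y)) then 1 else 0) := by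
        rw [Finset.card_filter]
    _ ≤ ∑ y : Fin n → Bool, ∑ r : Fin n, (if (L y ∧ E (rot r.val y)) then 1 else 0) := by
        refine sum_le_sum fun y _ => ?_
        by_cases h : L y ∧ ∃ r : Fin n, E (rot r.val y)
        · obtain ⟨hLy, r₀, hr₀⟩ := h
          rw [if_pos ⟨hLy, r₀, hr₀⟩]
          have h1 : (if (L y ∧ E (rot r₀.val y)) then 1 else 0) ≤
              ∑ r : Fin n, (if (L y ∧ E (rot r.val y)) then 1 else 0) :=
            Finset.single_le_sum (f := fun r : Fin n => if (L y ∧ E (rot r.val y)) then 1 else 0)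
              (fun _ _ => Nat.zero_le _) (mem_univ r₀)
          rw [if_pos ⟨hLy, hr₀⟩] at h1
          exact h1
        · rw [if_neg h]
          exact Nat.zero_le _
    _ = ∑ r : Fin n, ∑ y : Fin n → Bool, (if (L y ∧ E (rot r.val y)) then 1 else 0) := Finset.sum_comm
    _ = ∑ r : Fin n, (univ.filter fun y => L y ∧ E (rot r.val y)).card := by
        simp only [Finset.card_filter]
    _ = ∑ _r : Fin n, (univ.filter fun y => L y ∧ E y).card :=
        sum_congr rfl fun r _ => card_inv_and_rot L E hL r.val
    _ = n * (univ.filter fun y => L y ∧ E y).card := by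
        rw [sum_const, card_univ, Fintype.card_fin, smul_eq_mul]

/-- **THE TRIANGULAR COUNT**: if a nonempty index set `S` sits inside `[0, M)`, at most `2^M` patterns have ALL their
`n` translate-parities `par S (rot r ·)` equal to one fixed bit `c` — the coordinates from `max S` on are determined
one by one by the coordinates below them (no polynomial gcd, no Fourier). -/
theorem card_allShifts_le (S : Finset (Fin n)) (M : ℕ) (hne : S.Nonempty) (hS : ∀ j ∈ S, j.val < M) (c : Bool) :
    (univ.filter fun y : Fin n → Bool => ∀ r : Fin n, par S (rot r.val y) = c).card ≤ 2 ^ M := by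
  set j₀ : Fin n := S.max' hne with hj₀
  have hj₀S : j₀ ∈ S := max'_mem S hne
  have hj₀M : j₀.val < M := hS j₀ hj₀S
  have hle : ∀ j ∈ S, j ≤ j₀ := fun j hj => le_max' S j hj
  -- the parity over `S` of a translate splits off the pivot `j₀`
  have hsplit : ∀ (a : ℕ) (y : Fin n → Bool), (S.filter fun j => rot a y j = true).card =
      ((S.erase j₀).filter fun j => rot a y j = true).card + (if rot a y j₀ = true then 1 else 0) := by
    intro a y
    conv_lhs => rw [← insert_erase hj₀S]
    rw [filter_insert]
    split_ifs with h
    · rw [card_insert_of_notMem]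
      intro hmem
      exact (notMem_erase j₀ S) (mem_of_mem_filter j₀ hmem)
    · rfl
  -- restriction to the coordinates `< M` (padded with `false`)
  let ρ : (Fin n → Bool) → (Fin M → Bool) := fun y i => if h : i.val < n then y ⟨i.val, h⟩ else false
  have hinj : Set.InjOn ρ ↑(univ.filter fun y : Fin n → Bool => ∀ r : Fin n, par S (rot r.val y) = c) := by
    intro y₁ hy₁ y₂ hy₂ hρ
    rw [coe_filter] at hy₁ hy₂
    have hz₁ : ∀ r : Fin n, par S (rot r.val y₁) = c := hy₁.2
    have hz₂ : ∀ r : Fin n, par S (rot r.val y₂) = c := hy₂.2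
    -- all coordinates agree, by strong induction
    have key : ∀ i : ℕ, ∀ hi : i < n, y₁ ⟨i, hi⟩ = y₂ ⟨i, hi⟩ := by
      intro i
      induction i using Nat.strong_induction_on with
      | _ i ih =>
        intro hi
        by_cases hlt : i < j₀.val
        · have h1 := congrFun hρ ⟨i, lt_trans hlt hj₀M⟩
          simp only [ρ, dif_pos hi] at h1
          exact h1
        · -- pivot step: translate by `a = i - j₀`
          have ha : j₀.val + (i - j₀.val) = i := by omega
          have han : i - j₀.val < n := by omega
          set a := i - j₀.val with hadef
          have h1 := hz₁ ⟨a, han⟩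
          have h2 := hz₂ ⟨a, han⟩
          simp only [par] at h1 h2
          -- the non-pivot part of the two parities agrees (induction hypothesis)
          have hcnt : ((S.erase j₀).filter fun j => rot a y₁ j = true) =
              ((S.erase j₀).filter fun j => rot a y₂ j = true) := by
            refine filter_congr fun j hj => ?_
            have hjS : j ∈ S := (mem_erase.mp hj).2
            have hjne : j ≠ j₀ := (mem_erase.mp hj).1
            have hjle : j.val ≤ j₀.val := hle j hjS
            have hjlt : j.val < j₀.val := lt_of_le_of_ne hjle (fun h => hjne (Fin.ext h))
            have hh : j.val + a < n := by omega
            have hlt' : j.val + a < i := by omega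
            rw [rot_apply_of_lt a y₁ j hh, rot_apply_of_lt a y₂ j hh, ih (j.val + a) hlt' hh]
          rw [hsplit a y₁, hcnt] at h1
          rw [hsplit a y₂] at h2
          -- the pivot bits agree
          have hh0 : j₀.val + a < n := by omega
          have e1 : rot a y₁ j₀ = y₁ ⟨j₀.val + a, hh0⟩ := rot_apply_of_lt a y₁ j₀ hh0
          have e2 : rot a y₂ j₀ = y₂ ⟨j₀.val + a, hh0⟩ := rot_apply_of_lt a y₂ j₀ hh0
          have ei : (⟨i, hi⟩ : Fin n) = ⟨j₀.val + a, hh0⟩ := Fin.ext ha.symm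
          rw [ei, ← e1, ← e2]
          have h12 := h1.trans h2.symm
          rw [decide_eq_decide] at h12
          set K := ((S.erase j₀).filter fun j => rot a y₂ j = true).card
          generalize rot a y₁ j₀ = b₁ at h12 ⊢
          generalize rot a y₂ j₀ = b₂ at h12 ⊢
          cases b₁ <;> cases b₂ <;> simp at h12 ⊢ <;> omega
    funext i
    exact key i.val i.isLt
  calc (univ.filter fun y : Fin n → Bool => ∀ r : Fin n, par S (rot r.val y) = c).card
      ≤ (univ : Finset (Fin M → Bool)).card :=
        Finset.card_le_card_of_injOn ρ (fun _ _ => mem_univ _) hinj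
    _ = 2 ^ M := by
        rw [card_univ, Fintype.card_fun, Fintype.card_bool, Fintype.card_fin]


end Summit.QuantumAdvantage.QuantumAdvantage.Theorems.OrbitAveraging
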